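import Literature.AlgebraicGeometry.KTheory.GrothendieckGroup
import Literature.AlgebraicGeometry.Modules.KernelFiniteLocallyFree
import Mathlib.CategoryTheory.Abelian.Refinements
import Mathlib.GroupTheory.MonoidLocalization.GrothendieckGroup
import HarnessLib

/-!
# Heller's criterion for equality of classes in `K₀(X)` (Grayson's form)

For an exact category `𝒩`, A. Heller's criterion describes WHEN two objects have the same class in
the Grothendieck group `K₀𝒩` purely in terms of objects and short exact sequences. We prove it, in
the form printed by D. Grayson (*Relative algebraic K-theory by elementary means*, arXiv:1310.8644,
Lemma 17, p. 8), for the exact category of vector bundles on a scheme `X`, i.e. for the tree's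
`Literature.AlgebraicGeometry.KTheory.KZero X` (the free abelian group on the finite locally free
`𝒪_X`-modules modulo `[E] = [E'] + [E'']` for short exact `0 → E' → E → E'' → 0`,
`KTheory/GrothendieckGroup`):

* `KZero.of_eq_of_iff_hellerRel` (**Grayson, Lemma 17**): for vector bundles `M`, `M'` on `X`,
  `[M] = [M']` in `K₀(X)` iff there exist vector bundles `V⁰, V¹, V²` and short exact sequences
  `0 → M ⊞ V⁰ → V¹ → V² → 0` and `0 → M' ⊞ V⁰ → V¹ → V² → 0` (no relationship between the maps of the
  two sequences is assumed) — the relation `Heller.Rel M M'`;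
* `KZero.of_eq_of_iff_exists_shortExact`: the same with the two sequences rendered as arbitrary
  short exact `ShortComplex`es of `𝒪_X`-modules whose terms are identified with `M ⊞ V⁰, V¹, V²`
  (resp. `M' ⊞ V⁰, V¹, V²`) by isomorphisms — the shape in which the criterion is consumed;
* `KZero.of_eq_of_iff_exists_fourTermExact` (**Grayson, Corollary 18**): `[M] = [M']` iff there
  exist vector bundles `V⁰, V¹, V²` and exact sequences `0 → M → V⁰ → V¹ → V² → 0` and
  `0 → M' → V⁰ → V¹ → V² → 0` (`HasFourTermExact`); with the additivity of `K₀` over four-term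
  exact sequences of vector bundles, `[M] + [V¹] = [V⁰] + [V²]` (`HasFourTermExact.kZero_eq`);
* `KZero.map_of_sub_of_eq_zero_iff`: `f^*([M] − [M']) = 0` in `K₀(Y)` iff `Heller.Rel (f^*M) (f^*M')`
  — the object-wise description of kernel classes of a pull-back `f^* : K₀(Z) → K₀(Y)`; since every
  class is a difference `[M] − [M']` (`KZero.exists_eq_of_sub_of`), this describes the whole kernel
  (`KZero.map_eq_zero_iff_exists_hellerRel`, §6 — the object-level content of Grayson's Lemma 19).

## The printed proof and this file

Grayson's proof (loc. cit.): write `M ∼ M'` for the condition. "The relation `∼` is a cancellative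
additive equivalence relation on the commutative monoid consisting of the isomorphism classes of `𝒩`,
where direct sum gives the addition operation. For example, additivity follows by forming direct sums
of the exact sequences involved. To show `M ∼ M` (reflexivity), one takes `E` and `E'` to be
`0 → M = M → 0 → 0`; compatibility with isomorphism is similar. Symmetry follows from interchanging
`E` and `E'`. To show `M ⊕ W ∼ M' ⊕ W ⟹ M ∼ M'` (cancellation), one replaces `V⁰` by `V⁰ ⊕ W`. To show
`M ∼ M' ∧ M' ∼ M'' ⟹ M ∼ M''` (transitivity), one uses additivity to deduce that `M ⊕ M' ∼ M' ⊕ M''`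
and then cancels `M'`." Then the quotient monoid `H = Ob 𝒩 / ∼` is cancellative, so it injects into
its group completion `G`; the assignment `M ↦ ⟨M⟩` is additive on short exact sequences (for
`0 → M' → M → M'' → 0` one has `M ∼ M' ⊕ M''` by the pair of sequences
`0 → M → M ⊕ M'' → M'' → 0`, `0 → M' ⊕ M'' → M ⊕ M'' → M'' → 0`), hence factors through a homomorphism
`K₀𝒩 → G`, and `[M] = [M']` forces `⟨M⟩ = ⟨M'⟩`, i.e. `M ∼ M'`. The converse is additivity of `K₀`.

We follow this architecture literally: §0 proves that the direct sum of two short exact sequences in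
an abelian category is short exact (the one categorical input, via refinements); §1 introduces the
relation `Heller.Rel` on `𝒪_X`-modules and proves reflexivity, symmetry, invariance under isomorphism,
additivity, cancellation, transitivity and the short-exact-sequence compatibility, each by the
displayed choice of `V⁰, V¹, V²`; §2 is the easy implication; §3 builds the quotient monoid
`Heller.Monoid X` of vector bundles modulo `∼`, shows it is a cancellative commutative monoid and maps
`K₀(X)` to its Grothendieck group (Mathlib's `Algebra.GrothendieckAddGroup`, injective on cancellative
monoids: `GrothendieckAddGroup.of_injective`) by the universal property `KZero.lift`; §4 assembles the
criterion; §5 derives Corollary 18 as printed ("Adding length `1` acyclic complexes formed from the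
maps `1_M` and `1_{M'}` to the short exact sequences provided by the Lemma"), the converse splitting a
four-term exact sequence of vector bundles at the kernel of its last map, a vector bundle by
`Modules/KernelFiniteLocallyFree` (Stacks 05P2). Deviation from the source: none in substance; the monoid is built on the (large) type of
vector bundles themselves rather than on isomorphism classes (isomorphic bundles are `∼`-equivalent,
`Heller.Rel.of_iso`, so the quotient is the same), exactly as `KZero X` itself is generated by
modules rather than by isomorphism classes.

## Why it is here

This is the first lemma of the elementary (generators-and-relations) approach to RELATIVE `K₀`:
Grayson's Corollary 18 and Lemma 19 (loc. cit., pp. 8–9) deduce from it the exactness of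
`K₀Ω[F] → K₀𝓜 → K₀𝓝` for an exact functor `F` (Theorem 7 / Corollary 9: the five-term sequence
`K₁𝓜 → K₁𝓝 → K₀Ω[F] → K₀𝓜 → K₀𝓝`), which for `F = i^* : Vect(X_n) → Vect(X_m)` is the exact sequence
`K₀(X_n, X_m) → K₀(X_n) → K₀(X_m)` entering X. Hu's kernel presentation
(`KTheory/HuInfinitesimalKZero`, fact `HuKZeroKernelPresentation`). It is also the tool by which a
computation "in `K₀(X)`" becomes a statement about vector bundles and short exact sequences.

## References

* D. R. Grayson, *Relative algebraic K-theory by elementary means*, arXiv:1310.8644 (2013),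
  Lemma 17, Corollary 18, Lemma 19. [Grayson2013RelativeKTheory]
* A. Heller, *Some exact sequences in algebraic K-theory*, Topology 3 (1965), 389–408.
  [Heller1965SomeExactSequences]
* W. Fulton, *Intersection theory*, §15.1 (the group `K⁰X`). [Fulton1998]
-/

universe u

open CategoryTheory CategoryTheory.Limits AlgebraicGeometry ZeroObject
open Literature.AlgebraicGeometry.Motives

noncomputable section

namespace Literature.AlgebraicGeometry.KTheory

/-! ## §0. Direct sums of short exact sequences -/

section Abelian

variable {C : Type*} [Category C] [Abelian C]

/-- The direct sum `S ⊞ T` of two short complexes `S.X₁ → S.X₂ → S.X₃`, `T.X₁ → T.X₂ → T.X₃` of an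
abelian category, termwise: `S.X₁ ⊞ T.X₁ → S.X₂ ⊞ T.X₂ → S.X₃ ⊞ T.X₃` with the maps `biprod.map`.
[folklore] -/
def biprodShortComplex (S T : ShortComplex C) : ShortComplex C :=
  ShortComplex.mk (biprod.map S.f T.f) (biprod.map S.g T.g) (by
    ext <;> simp [S.zero_assoc, T.zero_assoc])

/-- First term of the direct sum of short complexes. [folklore] -/
@[simp] lemma biprodShortComplex_X₁ (S T : ShortComplex C) :
    (biprodShortComplex S T).X₁ = (S.X₁ ⊞ T.X₁) := rfl
/-- Middle term of the direct sum of short complexes. [folklore] -/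
@[simp] lemma biprodShortComplex_X₂ (S T : ShortComplex C) :
    (biprodShortComplex S T).X₂ = (S.X₂ ⊞ T.X₂) := rfl
/-- Last term of the direct sum of short complexes. [folklore] -/
@[simp] lemma biprodShortComplex_X₃ (S T : ShortComplex C) :
    (biprodShortComplex S T).X₃ = (S.X₃ ⊞ T.X₃) := rfl
/-- First map of the direct sum of short complexes. [folklore] -/
@[simp] lemma biprodShortComplex_f (S T : ShortComplex C) :
    (biprodShortComplex S T).f = biprod.map S.f T.f := rfl
/-- Second map of the direct sum of short complexes. [folklore] -/
@[simp] lemma biprodShortComplex_g (S T : ShortComplex C) :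
    (biprodShortComplex S T).g = biprod.map S.g T.g := rfl

/-- **The direct sum of two exact short complexes is exact**, proved by refinements: a local section of `ker (S.g ⊞ T.g)` lifts, after an epimorphic
refinement, componentwise to `S.X₁ ⊞ T.X₁`. [folklore] -/
theorem exact_biprodShortComplex {S T : ShortComplex C} (hS : S.Exact) (hT : T.Exact) :
    (biprodShortComplex S T).Exact := by
  refine (ShortComplex.exact_iff_exact_up_to_refinements _).2
    fun A (x₂ : A ⟶ S.X₂ ⊞ T.X₂) (hx₂ : x₂ ≫ biprod.map S.g T.g = 0) ↦ ?_
  have h₁ : (x₂ ≫ biprod.fst) ≫ S.g = 0 := by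
    simpa only [Category.assoc, biprod.map_fst, zero_comp] using hx₂ =≫ biprod.fst
  have h₂ : (x₂ ≫ biprod.snd) ≫ T.g = 0 := by
    simpa only [Category.assoc, biprod.map_snd, zero_comp] using hx₂ =≫ biprod.snd
  obtain ⟨A', π, _, x₁, hx₁⟩ := hS.exact_up_to_refinements _ h₁
  have h₂' : (π ≫ x₂ ≫ biprod.snd) ≫ T.g = 0 := by
    simp only [Category.assoc] at h₂ ⊢; rw [h₂, comp_zero]
  obtain ⟨A'', π', _, y₁, hy₁⟩ := hT.exact_up_to_refinements _ h₂'
  refine ⟨A'', π' ≫ π, epi_comp _ _, biprod.lift (π' ≫ x₁) y₁, ?_⟩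
  change (π' ≫ π) ≫ x₂ = biprod.lift (π' ≫ x₁) y₁ ≫ biprod.map S.f T.f
  refine biprod.hom_ext _ _ ?_ ?_
  · simp only [Category.assoc, biprod.map_fst, biprod.lift_fst_assoc]
    rw [hx₁]
  · simp only [Category.assoc, biprod.map_snd, biprod.lift_snd_assoc]
    rw [← hy₁]

/-- **The direct sum of two short exact sequences is short exact** (Grayson, proof of Lemma 17:
"additivity follows by forming direct sums of the exact sequences involved").
[cite: Grayson2013RelativeKTheory, Lemma 17 (proof)] -/
theorem shortExact_biprodShortComplex {S T : ShortComplex C} (hS : S.ShortExact)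
    (hT : T.ShortExact) : (biprodShortComplex S T).ShortExact := by
  have := hS.mono_f; have := hT.mono_f; have := hS.epi_g; have := hT.epi_g
  exact ShortComplex.ShortExact.mk' (exact_biprodShortComplex hS.exact hT.exact)
    (by change Mono (biprod.map S.f T.f); infer_instance)
    (by change Epi (biprod.map S.g T.g); infer_instance)

/-- Exactness of short complexes is unchanged along a morphism `S₁ ⟶ S₂` which is epi on `X₁`, an
isomorphism on `X₂` and mono on `X₃` (Mathlib's `ShortComplex.exact_iff_of_epi_of_isIso_of_mono`,
repackaged with the three components explicit so that the instances are found on them). [folklore] -/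
theorem exact_iff_of_epi_iso_mono {S₁ S₂ : ShortComplex C} (τ₁ : S₁.X₁ ⟶ S₂.X₁) [Epi τ₁]
    (τ₂ : S₁.X₂ ≅ S₂.X₂) (τ₃ : S₁.X₃ ⟶ S₂.X₃) [Mono τ₃] (comm₁₂ : τ₁ ≫ S₂.f = S₁.f ≫ τ₂.hom)
    (comm₂₃ : τ₂.hom ≫ S₂.g = S₁.g ≫ τ₃) : S₁.Exact ↔ S₂.Exact := by
  let φ : S₁ ⟶ S₂ := ShortComplex.homMk τ₁ τ₂.hom τ₃ comm₁₂ comm₂₃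
  have : Epi φ.τ₁ := ‹Epi τ₁›
  have : IsIso φ.τ₂ := by change IsIso τ₂.hom; infer_instance
  have : Mono φ.τ₃ := ‹Mono τ₃›
  exact ShortComplex.exact_iff_of_epi_of_isIso_of_mono φ

/-- The inner shuffle `(M ⊞ N) ⊞ (V ⊞ W) ≅ (M ⊞ V) ⊞ (N ⊞ W)` of binary biproducts. [folklore] -/
def biprodShuffle (M N V W : C) : (M ⊞ N) ⊞ (V ⊞ W) ≅ (M ⊞ V) ⊞ (N ⊞ W) where
  hom := biprod.lift (biprod.map biprod.fst biprod.fst) (biprod.map biprod.snd biprod.snd)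
  inv := biprod.lift (biprod.map biprod.fst biprod.fst) (biprod.map biprod.snd biprod.snd)
  hom_inv_id := by ext <;> simp
  inv_hom_id := by ext <;> simp

/-- `HasSES A V₁ V₂`: there is a short exact sequence `0 → A → V₁ → V₂ → 0` (the existence of SOME
maps; Grayson's `E : 0 → M ⊕ V⁰ → V¹ → V² → 0` "we assume no relationship between the maps").
[cite: Grayson2013RelativeKTheory, Lemma 17] -/
def HasSES (A V₁ V₂ : C) : Prop :=
  ∃ (f : A ⟶ V₁) (g : V₁ ⟶ V₂) (w : f ≫ g = 0), (ShortComplex.mk f g w).ShortExact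

namespace HasSES

variable {A V₁ V₂ B W₁ W₂ A' V₁' V₂' : C}

/-- A short exact short complex witnesses `HasSES` of its terms. [folklore] -/
theorem of_shortExact {S : ShortComplex C} (hS : S.ShortExact) : HasSES S.X₁ S.X₂ S.X₃ :=
  ⟨S.f, S.g, S.zero, hS⟩

/-- `HasSES` is invariant under isomorphisms of the three terms. [folklore] -/
theorem of_iso (h : HasSES A V₁ V₂) (e₁ : A' ≅ A) (e₂ : V₁' ≅ V₁) (e₃ : V₂' ≅ V₂) :
    HasSES A' V₁' V₂' := by
  obtain ⟨f, g, w, hS⟩ := h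
  refine ⟨e₁.hom ≫ f ≫ e₂.inv, e₂.hom ≫ g ≫ e₃.inv, by simp [reassoc_of% w], ?_⟩
  refine (ShortComplex.shortExact_iff_of_iso ?_).2 hS
  exact ShortComplex.isoMk e₁ e₂ e₃ (by simp) (by simp)

/-- **Direct sums**: `HasSES A V₁ V₂ → HasSES B W₁ W₂ → HasSES (A ⊞ B) (V₁ ⊞ W₁) (V₂ ⊞ W₂)`.
[cite: Grayson2013RelativeKTheory, Lemma 17 (proof)] -/
theorem biprod (h : HasSES A V₁ V₂) (h' : HasSES B W₁ W₂) :
    HasSES (A ⊞ B) (V₁ ⊞ W₁) (V₂ ⊞ W₂) := by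
  obtain ⟨f, g, w, hS⟩ := h
  obtain ⟨f', g', w', hT⟩ := h'
  exact ⟨_, _, _, shortExact_biprodShortComplex hS hT⟩

variable (A)

/-- The short exact sequence `0 → A = A → 0 → 0`. [folklore] -/
theorem id_zero : HasSES A A 0 := by
  refine ⟨𝟙 A, 0, by simp, ?_⟩
  exact { exact := (ShortComplex.exact_iff_epi _ rfl).2 (by dsimp; infer_instance)
          mono_f := by dsimp; infer_instance
          epi_g := (isZero_zero C).epi _ }

/-- The short exact sequence `0 → 0 → A = A → 0`. [folklore] -/
theorem zero_id : HasSES 0 A A := by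
  refine ⟨0, 𝟙 A, by simp, ?_⟩
  exact { exact := (ShortComplex.exact_iff_mono _ rfl).2 (by dsimp; infer_instance)
          mono_f := (isZero_zero C).mono _
          epi_g := by dsimp; infer_instance }

end HasSES

end Abelian

/-! ## §1. Heller's relation on `𝒪_X`-modules -/

variable {X : Scheme.{u}}

namespace Heller

/-- **Heller's relation** (Grayson's form): `Rel M M'` iff there are VECTOR BUNDLES `V⁰, V¹, V²` on
`X` and short exact sequences `0 → M ⊞ V⁰ → V¹ → V² → 0` and `0 → M' ⊞ V⁰ → V¹ → V² → 0` of
`𝒪_X`-modules ("we assume no relationship between the maps of `E` and the maps of `E'`").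
[cite: Grayson2013RelativeKTheory, Lemma 17] -/
def Rel (M M' : X.Modules) : Prop :=
  ∃ (V₀ V₁ V₂ : X.Modules), IsFiniteLocallyFree V₀ ∧ IsFiniteLocallyFree V₁ ∧
    IsFiniteLocallyFree V₂ ∧ HasSES (M ⊞ V₀) V₁ V₂ ∧ HasSES (M' ⊞ V₀) V₁ V₂

namespace Rel

variable {M M' M'' N N' W : X.Modules}

/-- Symmetry: "interchange `E` and `E'`". [cite: Grayson2013RelativeKTheory, Lemma 17 (proof)] -/
theorem symm (h : Rel M M') : Rel M' M := by
  obtain ⟨V₀, V₁, V₂, h₀, h₁, h₂, hE, hE'⟩ := h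
  exact ⟨V₀, V₁, V₂, h₀, h₁, h₂, hE', hE⟩

/-- Compatibility with isomorphism: `M ≅ M'` (with `M'` a vector bundle) gives `Rel M M'`, by
`V⁰ = 0`, `V¹ = M' ⊞ 0`, `V² = 0` and the sequences `0 → M ⊞ 0 ≅ M' ⊞ 0 → 0 → 0`,
`0 → M' ⊞ 0 = M' ⊞ 0 → 0 → 0`. [cite: Grayson2013RelativeKTheory, Lemma 17 (proof)] -/
theorem of_iso (e : M ≅ M') (hM' : IsFiniteLocallyFree M') : Rel M M' :=
  ⟨0, M' ⊞ 0, 0, KZero.isFiniteLocallyFree_of_isZero (isZero_zero _),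
    KZero.isFiniteLocallyFree_biprod hM' (KZero.isFiniteLocallyFree_of_isZero (isZero_zero _)),
    KZero.isFiniteLocallyFree_of_isZero (isZero_zero _),
    (HasSES.id_zero (M' ⊞ 0)).of_iso (biprod.mapIso e (Iso.refl 0)) (Iso.refl _) (Iso.refl _),
    HasSES.id_zero (M' ⊞ 0)⟩

/-- Reflexivity on vector bundles: "one takes `E` and `E'` to be `0 → M = M → 0 → 0`".
[cite: Grayson2013RelativeKTheory, Lemma 17 (proof)] -/
theorem refl (hM : IsFiniteLocallyFree M) : Rel M M := of_iso (Iso.refl M) hM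

/-- Transport of the left argument along an isomorphism. [folklore] -/
theorem congr_left (h : Rel M N) (e : M' ≅ M) : Rel M' N := by
  obtain ⟨V₀, V₁, V₂, h₀, h₁, h₂, hE, hE'⟩ := h
  exact ⟨V₀, V₁, V₂, h₀, h₁, h₂, hE.of_iso (biprod.mapIso e (Iso.refl V₀)) (Iso.refl _) (Iso.refl _),
    hE'⟩

/-- Transport of the right argument along an isomorphism. [folklore] -/
theorem congr_right (h : Rel M N) (e : N' ≅ N) : Rel M N' :=
  ((h.symm).congr_left e).symm

/-- **Additivity**: `Rel M M' → Rel N N' → Rel (M ⊞ N) (M' ⊞ N')`, "by forming direct sums of the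
exact sequences involved" (and reshuffling `(M ⊞ N) ⊞ (V⁰ ⊞ W⁰) ≅ (M ⊞ V⁰) ⊞ (N ⊞ W⁰)`).
[cite: Grayson2013RelativeKTheory, Lemma 17 (proof)] -/
theorem add (h : Rel M M') (h' : Rel N N') : Rel (M ⊞ N) (M' ⊞ N') := by
  obtain ⟨V₀, V₁, V₂, h₀, h₁, h₂, hE, hE'⟩ := h
  obtain ⟨W₀, W₁, W₂, k₀, k₁, k₂, hF, hF'⟩ := h'
  exact ⟨V₀ ⊞ W₀, V₁ ⊞ W₁, V₂ ⊞ W₂, KZero.isFiniteLocallyFree_biprod h₀ k₀,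
    KZero.isFiniteLocallyFree_biprod h₁ k₁, KZero.isFiniteLocallyFree_biprod h₂ k₂,
    (hE.biprod hF).of_iso (biprodShuffle M N V₀ W₀) (Iso.refl _) (Iso.refl _),
    (hE'.biprod hF').of_iso (biprodShuffle M' N' V₀ W₀) (Iso.refl _) (Iso.refl _)⟩

/-- **Cancellation**: `Rel (M ⊞ W) (M' ⊞ W) → Rel M M'` for a vector bundle `W`, "one replaces `V⁰` by
`V⁰ ⊕ W`" (here `W ⊞ V⁰`, reassociating `M ⊞ (W ⊞ V⁰) ≅ (M ⊞ W) ⊞ V⁰`).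
[cite: Grayson2013RelativeKTheory, Lemma 17 (proof)] -/
theorem cancel (h : Rel (M ⊞ W) (M' ⊞ W)) (hW : IsFiniteLocallyFree W) : Rel M M' := by
  obtain ⟨V₀, V₁, V₂, h₀, h₁, h₂, hE, hE'⟩ := h
  exact ⟨W ⊞ V₀, V₁, V₂, KZero.isFiniteLocallyFree_biprod hW h₀, h₁, h₂,
    hE.of_iso (biprod.associator M W V₀).symm (Iso.refl _) (Iso.refl _),
    hE'.of_iso (biprod.associator M' W V₀).symm (Iso.refl _) (Iso.refl _)⟩

/-- **Transitivity** through a vector bundle `M'`: "one uses additivity to deduce that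
`M ⊕ M' ∼ M' ⊕ M''` and then cancels `M'`". [cite: Grayson2013RelativeKTheory, Lemma 17 (proof)] -/
theorem trans (h : Rel M M') (h' : Rel M' M'') (hM' : IsFiniteLocallyFree M') : Rel M M'' :=
  ((h.add h').congr_right (biprod.braiding M'' M')).cancel hM'

/-- **Compatibility with short exact sequences**: for a short exact sequence `0 → M' → M → M'' → 0`
of vector bundles, `Rel M (M' ⊞ M'')`, by the pair of short exact sequences
`0 → M → M ⊕ M'' → M'' → 0` and `0 → M' ⊕ M'' → M ⊕ M'' → M'' → 0` (Grayson, proof of Lemma 17, the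
displayed diagram) — here realised as the direct sums `(0 → M = M → 0) ⊞ (0 → 0 → M'' = M'')` and
`(0 → M' → M → M'') ⊞ (0 → M'' = M'' → 0)`, with `V⁰ = 0`, `V¹ = M ⊞ M''`, `V² = 0 ⊞ M''`.
[cite: Grayson2013RelativeKTheory, Lemma 17 (proof)] -/
theorem of_shortExact {S : ShortComplex X.Modules} (hS : S.ShortExact)
    (h₂ : IsFiniteLocallyFree S.X₂) (h₃ : IsFiniteLocallyFree S.X₃) :
    Rel S.X₂ (S.X₁ ⊞ S.X₃) := by
  have h0 : IsFiniteLocallyFree (0 : X.Modules) :=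
    KZero.isFiniteLocallyFree_of_isZero (isZero_zero _)
  refine ⟨0, S.X₂ ⊞ S.X₃, 0 ⊞ S.X₃, h0, KZero.isFiniteLocallyFree_biprod h₂ h₃,
    KZero.isFiniteLocallyFree_biprod h0 h₃, (HasSES.id_zero S.X₂).biprod (HasSES.zero_id S.X₃), ?_⟩
  exact ((HasSES.of_shortExact hS).biprod (HasSES.id_zero S.X₃)).of_iso
    (isoBiprodZero (isZero_zero _)).symm (Iso.refl _) (biprod.braiding 0 S.X₃)

end Rel

/-! ## §2. The easy implication: `Rel M M' → [M] = [M']` -/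

/-- Additivity of `K₀` along a `HasSES` of vector bundles: `[V¹] = [A] + [V²]`. [folklore] -/
theorem _root_.Literature.AlgebraicGeometry.KTheory.HasSES.kZero_of_eq {A V₁ V₂ : X.Modules} (h : HasSES A V₁ V₂) (hA : IsFiniteLocallyFree A)
    (h₁ : IsFiniteLocallyFree V₁) (h₂ : IsFiniteLocallyFree V₂) :
    KZero.of V₁ h₁ = KZero.of A hA + KZero.of V₂ h₂ := by
  obtain ⟨f, g, w, hS⟩ := h
  exact KZero.of_shortExact hS hA h₁ h₂

/-- **Heller's criterion, easy half**: `Rel M M' → [M] = [M']` in `K₀(X)` ("follows from additivity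
and the existence of `E` and `E'`": `[M] + [V⁰] + [V²] = [V¹] = [M'] + [V⁰] + [V²]`).
[cite: Grayson2013RelativeKTheory, Lemma 17] -/
theorem Rel.kZero_of_eq {M M' : X.Modules} (h : Rel M M') (hM : IsFiniteLocallyFree M)
    (hM' : IsFiniteLocallyFree M') : KZero.of M hM = KZero.of M' hM' := by
  obtain ⟨V₀, V₁, V₂, h₀, h₁, h₂, hE, hE'⟩ := h
  have e₁ := hE.kZero_of_eq (KZero.isFiniteLocallyFree_biprod hM h₀) h₁ h₂
  have e₂ := hE'.kZero_of_eq (KZero.isFiniteLocallyFree_biprod hM' h₀) h₁ h₂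
  rw [KZero.of_biprod hM h₀] at e₁
  rw [KZero.of_biprod hM' h₀, e₁] at e₂
  have : KZero.of M hM + (KZero.of V₀ h₀ + KZero.of V₂ h₂) =
      KZero.of M' hM' + (KZero.of V₀ h₀ + KZero.of V₂ h₂) := by
    simpa only [add_assoc] using e₂
  exact add_right_cancel this

/-! ## §3. The cancellative monoid of vector bundles modulo `Rel` and its group completion -/

variable (X)

/-- Heller's relation as a setoid on the vector bundles on `X` (an equivalence relation: reflexive
on vector bundles, symmetric, transitive through vector bundles).
[cite: Grayson2013RelativeKTheory, Lemma 17 (proof)] -/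
def setoid : Setoid (VectorBundleObj X) where
  r M M' := Rel M.1 M'.1
  iseqv := ⟨fun M ↦ Rel.refl M.2, fun h ↦ h.symm, fun {_ M' _} h h' ↦ h.trans h' M'.2⟩

/-- **The monoid `H`** of vector bundles on `X` modulo Heller's relation ("the commutative monoid of
equivalence classes of objects of `𝒩` modulo `∼`"). [cite: Grayson2013RelativeKTheory, Lemma 17 (proof)] -/
def Monoid : Type (u + 1) := Quotient (setoid X)

variable {X}

namespace Monoid

/-- The class `⟨M⟩ ∈ H` of a vector bundle. [cite: Grayson2013RelativeKTheory, Lemma 17 (proof)] -/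
def mk (M : X.Modules) (hM : IsFiniteLocallyFree M) : Monoid X :=
  Quotient.mk (setoid X) ⟨M, hM⟩

/-- Two vector bundles have the same class in `H` iff they are Heller-related.
[cite: Grayson2013RelativeKTheory, Lemma 17 (proof)] -/
theorem mk_eq_mk_iff {M M' : X.Modules} (hM : IsFiniteLocallyFree M)
    (hM' : IsFiniteLocallyFree M') : mk M hM = mk M' hM' ↔ Rel M M' :=
  Quotient.eq (r := setoid X)

/-- Every element of `H` is the class of a vector bundle. [folklore] -/
theorem mk_surjective : Function.Surjective (fun M : VectorBundleObj X ↦ mk M.1 M.2) :=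
  Quotient.mk_surjective

/-- Direct sum descends to `H` (additivity of `Rel`). [cite: Grayson2013RelativeKTheory, Lemma 17 (proof)] -/
instance instAdd : Add (Monoid X) where
  add := Quotient.map₂ (fun M N : VectorBundleObj X ↦
      (⟨M.1 ⊞ N.1, KZero.isFiniteLocallyFree_biprod M.2 N.2⟩ : VectorBundleObj X))
    (fun _ _ h _ _ h' ↦ Rel.add h h')

/-- The class of the zero bundle. [folklore] -/
instance instZero : Zero (Monoid X) where
  zero := mk 0 (KZero.isFiniteLocallyFree_of_isZero (isZero_zero _))

/-- Addition in `H` is the direct sum on representatives ("direct sum gives the addition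
operation"). [cite: Grayson2013RelativeKTheory, Lemma 17 (proof)] -/
theorem mk_add_mk {M N : X.Modules} (hM : IsFiniteLocallyFree M) (hN : IsFiniteLocallyFree N) :
    mk M hM + mk N hN = mk (M ⊞ N) (KZero.isFiniteLocallyFree_biprod hM hN) := rfl

/-- The zero of `H` is the class of the zero bundle. [folklore] -/
theorem zero_def : (0 : Monoid X) = mk 0 (KZero.isFiniteLocallyFree_of_isZero (isZero_zero _)) :=
  rfl

/-- **`H` is a commutative monoid** under direct sum (associativity, unit and commutativity hold up
to isomorphism, and `Rel` is invariant under isomorphism). [cite: Grayson2013RelativeKTheory, Lemma 17 (proof)] -/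
instance instAddCommMonoid : AddCommMonoid (Monoid X) where
  add_assoc := by
    rintro ⟨a⟩ ⟨b⟩ ⟨c⟩
    exact Quotient.sound (Rel.of_iso (biprod.associator a.1 b.1 c.1)
      (KZero.isFiniteLocallyFree_biprod a.2 (KZero.isFiniteLocallyFree_biprod b.2 c.2)))
  zero_add := by
    rintro ⟨a⟩
    exact Quotient.sound (Rel.of_iso (isoZeroBiprod (isZero_zero _)).symm a.2)
  add_zero := by
    rintro ⟨a⟩
    exact Quotient.sound (Rel.of_iso (isoBiprodZero (isZero_zero _)).symm a.2)
  add_comm := by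
    rintro ⟨a⟩ ⟨b⟩
    exact Quotient.sound (Rel.of_iso (biprod.braiding a.1 b.1)
      (KZero.isFiniteLocallyFree_biprod b.2 a.2))
  nsmul := nsmulRec

/-- **`H` is cancellative** ("To show `M ⊕ W ∼ M' ⊕ W ⟹ M ∼ M'` (cancellation), one replaces `V⁰` by
`V⁰ ⊕ W`"). [cite: Grayson2013RelativeKTheory, Lemma 17 (proof)] -/
instance instIsCancelAdd : IsCancelAdd (Monoid X) where
  add_left_cancel := by
    rintro ⟨a⟩ ⟨b⟩ ⟨c⟩ h
    have h' : Rel (a.1 ⊞ b.1) (a.1 ⊞ c.1) := Quotient.exact h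
    exact Quotient.sound
      (((h'.congr_left (biprod.braiding b.1 a.1)).congr_right (biprod.braiding c.1 a.1)).cancel a.2)
  add_right_cancel := by
    rintro ⟨a⟩ ⟨b⟩ ⟨c⟩ h
    have h' : Rel (b.1 ⊞ a.1) (c.1 ⊞ a.1) := Quotient.exact h
    exact Quotient.sound (h'.cancel a.2)

/-- **The comparison homomorphism `K₀(X) → G`** to the Grothendieck group `G` of `H`, `[M] ↦ ⟨M⟩`
("There is also a well defined homomorphism `K₀𝒩 → G` defined on generators by `[M] ↦ ⟨M⟩`, because
the relation is additive over short exact sequences"), by the universal property `KZero.lift` and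
`Rel.of_shortExact`. [cite: Grayson2013RelativeKTheory, Lemma 17 (proof)] -/
def ofKZero : KZero X →+ Algebra.GrothendieckAddGroup (Monoid X) :=
  KZero.lift (fun E hE ↦ Algebra.GrothendieckAddGroup.of (mk E hE))
    (fun S hS h₁ h₂ h₃ ↦ by
      rw [← map_add, mk_add_mk]
      congr 1
      exact (mk_eq_mk_iff _ _).2 (Rel.of_shortExact hS h₂ h₃))

/-- The comparison homomorphism on a class: `[E] ↦ ⟨E⟩`.
[cite: Grayson2013RelativeKTheory, Lemma 17 (proof)] -/
@[simp]
theorem ofKZero_of (E : X.Modules) (hE : IsFiniteLocallyFree E) :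
    ofKZero (KZero.of E hE) = Algebra.GrothendieckAddGroup.of (mk E hE) :=
  KZero.lift_of _ _ E hE

end Monoid

end Heller

/-! ## §4. Heller's criterion -/

/-- **Heller's criterion (Grayson, Lemma 17).** For vector bundles `M`, `M'` on a scheme `X`,
`[M] = [M']` in `K₀(X)` if and only if there exist vector bundles `V⁰, V¹, V²` and short exact
sequences `0 → M ⊞ V⁰ → V¹ → V² → 0` and `0 → M' ⊞ V⁰ → V¹ → V² → 0`. ("Let `𝒩` be an exact category,
and consider objects `M, M' ∈ 𝒩`. Their classes `[M]` and `[M']` in `K₀𝒩` are equal if and only if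
there exist objects `V⁰, V¹, V²` of `𝒩` and exact sequences of the form `E : 0 → M ⊕ V⁰ → V¹ → V² → 0`
and `E' : 0 → M' ⊕ V⁰ → V¹ → V² → 0`." — here for `𝒩 = Vect(X)` and the tree's `KZero X`.) Proof:
§3's homomorphism `K₀(X) → G` and the injectivity of `H → G` for the cancellative monoid `H`
(`Algebra.GrothendieckAddGroup.of_injective`). [cite: Grayson2013RelativeKTheory, Lemma 17] -/
theorem KZero.of_eq_of_iff_hellerRel {M M' : X.Modules} (hM : IsFiniteLocallyFree M)
    (hM' : IsFiniteLocallyFree M') : KZero.of M hM = KZero.of M' hM' ↔ Heller.Rel M M' := by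
  refine ⟨fun h ↦ ?_, fun h ↦ h.kZero_of_eq hM hM'⟩
  have h' := congr_arg Heller.Monoid.ofKZero h
  rw [Heller.Monoid.ofKZero_of, Heller.Monoid.ofKZero_of] at h'
  exact (Heller.Monoid.mk_eq_mk_iff hM hM').1 (Algebra.GrothendieckAddGroup.of_injective h')

/-- **Heller's criterion, `ShortComplex` form.** `[M] = [M']` in `K₀(X)` iff there are vector bundles
`V⁰, V¹, V²` and two short exact `ShortComplex`es of `𝒪_X`-modules whose terms are isomorphic to
`M ⊞ V⁰, V¹, V²`, resp. `M' ⊞ V⁰, V¹, V²` (the shape in which the criterion is quoted by the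
consumers; equivalent to `KZero.of_eq_of_iff_hellerRel` since short exactness is invariant under
isomorphism of short complexes). [cite: Grayson2013RelativeKTheory, Lemma 17] -/
theorem KZero.of_eq_of_iff_exists_shortExact {M M' : X.Modules} (hM : IsFiniteLocallyFree M)
    (hM' : IsFiniteLocallyFree M') :
    KZero.of M hM = KZero.of M' hM' ↔
      ∃ (V₀ V₁ V₂ : X.Modules) (_ : IsFiniteLocallyFree V₀) (_ : IsFiniteLocallyFree V₁)
        (_ : IsFiniteLocallyFree V₂) (S S' : ShortComplex X.Modules),
        S.ShortExact ∧ S'.ShortExact ∧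
        Nonempty (S.X₁ ≅ M ⊞ V₀) ∧ Nonempty (S.X₂ ≅ V₁) ∧ Nonempty (S.X₃ ≅ V₂) ∧
        Nonempty (S'.X₁ ≅ M' ⊞ V₀) ∧ Nonempty (S'.X₂ ≅ V₁) ∧ Nonempty (S'.X₃ ≅ V₂) := by
  rw [KZero.of_eq_of_iff_hellerRel hM hM']
  constructor
  · rintro ⟨V₀, V₁, V₂, h₀, h₁, h₂, ⟨f, g, w, hS⟩, ⟨f', g', w', hS'⟩⟩
    exact ⟨V₀, V₁, V₂, h₀, h₁, h₂, _, _, hS, hS', ⟨Iso.refl _⟩, ⟨Iso.refl _⟩, ⟨Iso.refl _⟩,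
      ⟨Iso.refl _⟩, ⟨Iso.refl _⟩, ⟨Iso.refl _⟩⟩
  · rintro ⟨V₀, V₁, V₂, h₀, h₁, h₂, S, S', hS, hS', ⟨e₁⟩, ⟨e₂⟩, ⟨e₃⟩, ⟨e₁'⟩, ⟨e₂'⟩, ⟨e₃'⟩⟩
    exact ⟨V₀, V₁, V₂, h₀, h₁, h₂,
      (HasSES.of_shortExact hS).of_iso e₁.symm e₂.symm e₃.symm,
      (HasSES.of_shortExact hS').of_iso e₁'.symm e₂'.symm e₃'.symm⟩

/-- **Kernel classes, object-wise.** A difference `[M] − [M']` of classes of vector bundles lies in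
the kernel of `f^* : K₀(Z) → K₀(Y)` iff `Rel (f^*M) (f^*M')` holds on `Y` — Heller's criterion
applied to `[f^*M] = [f^*M']` (the form used in Grayson's Lemma 19 to prove exactness of
`K₀Ω[F] → K₀𝓜 → K₀𝓝` at `K₀𝓜`). [cite: Grayson2013RelativeKTheory, Lemma 17, Lemma 19 (proof)] -/
theorem KZero.map_of_sub_of_eq_zero_iff {Y Z : Scheme.{u}} (f : Y ⟶ Z) {M M' : Z.Modules}
    (hM : IsFiniteLocallyFree M) (hM' : IsFiniteLocallyFree M') :
    KZero.map f (KZero.of M hM - KZero.of M' hM') = 0 ↔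
      Heller.Rel ((Scheme.Modules.pullback f).obj M) ((Scheme.Modules.pullback f).obj M') := by
  rw [map_sub, sub_eq_zero, KZero.map_of, KZero.map_of, KZero.of_eq_of_iff_hellerRel]

/-! ## §5. Grayson's Corollary 18: four-term exact sequences -/

section FourTerm

variable {C : Type*} [Category C] [Abelian C]

/-- `HasFourTermExact M V₀ V₁ V₂`: there is an exact sequence `0 → M → V₀ → V₁ → V₂ → 0`, i.e. maps
`a : M → V₀`, `b : V₀ → V₁`, `c : V₁ → V₂` with `a` mono, `c` epi, and `M → V₀ → V₁`, `V₀ → V₁ → V₂`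
exact (Grayson: "exact sequences of the form `E : 0 → M → V⁰ → V¹ → V² → 0`").
[cite: Grayson2013RelativeKTheory, Corollary 18] -/
def HasFourTermExact (M V₀ V₁ V₂ : C) : Prop :=
  ∃ (a : M ⟶ V₀) (b : V₀ ⟶ V₁) (c : V₁ ⟶ V₂) (wab : a ≫ b = 0) (wbc : b ≫ c = 0),
    Mono a ∧ Epi c ∧ (ShortComplex.mk a b wab).Exact ∧ (ShortComplex.mk b c wbc).Exact

namespace HasFourTermExact

/-- Transport of a four-term exact sequence along an isomorphism of its second term. [folklore] -/
theorem of_iso₀ {M V₀ V₀' V₁ V₂ : C} (h : HasFourTermExact M V₀ V₁ V₂) (e : V₀' ≅ V₀) :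
    HasFourTermExact M V₀' V₁ V₂ := by
  obtain ⟨a, b, c, wab, wbc, ha, hc, hab, hbc⟩ := h
  refine ⟨a ≫ e.inv, e.hom ≫ b, c, by simp [wab], by simp [wbc], mono_comp _ _, hc, ?_, ?_⟩
  · refine (ShortComplex.exact_iff_of_iso ?_).1 hab
    exact ShortComplex.isoMk (Iso.refl _) e.symm (Iso.refl _) (by simp) (by simp)
  · exact (exact_iff_of_epi_iso_mono (S₁ := ShortComplex.mk (e.hom ≫ b) c (by simp [wbc]))
      (S₂ := ShortComplex.mk b c wbc) e.hom (Iso.refl _) (𝟙 _) (by simp) (by simp)).2 hbc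

/-- **From Heller data to a four-term exact sequence** (Grayson, proof of Corollary 18: "Adding
length `1` acyclic complexes formed from the maps `1_M` and `1_{M'}` to the short exact sequences
provided by the Lemma"): a short exact sequence `0 → N ⊞ V⁰ →ᶠ V¹ →ᵍ V² → 0` and any object `M` give
the exact sequence `0 → M →⁽ⁱⁿˡ⁾ M ⊞ (N ⊞ V⁰) →⁽ˢⁿᵈ ≫ ᶠ⁾ V¹ →ᵍ V² → 0`.
[cite: Grayson2013RelativeKTheory, Corollary 18 (proof)] -/
theorem of_hasSES {N V₀ V₁ V₂ : C} (h : HasSES (N ⊞ V₀) V₁ V₂) (M : C) :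
    HasFourTermExact M (M ⊞ (N ⊞ V₀)) V₁ V₂ := by
  obtain ⟨f, g, w, hS⟩ := h
  have := hS.mono_f
  refine ⟨biprod.inl, biprod.snd ≫ f, g, by simp, by simp [w], inferInstance, hS.epi_g, ?_, ?_⟩
  · have h0 : (ShortComplex.mk (biprod.inl : M ⟶ M ⊞ (N ⊞ V₀)) biprod.snd (by simp)).Exact :=
      (ShortComplex.Splitting.ofHasBinaryBiproduct M (N ⊞ V₀)).exact
    exact (exact_iff_of_epi_iso_mono
      (S₁ := ShortComplex.mk (biprod.inl : M ⟶ M ⊞ (N ⊞ V₀)) biprod.snd (by simp))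
      (S₂ := ShortComplex.mk (biprod.inl : M ⟶ M ⊞ (N ⊞ V₀)) (biprod.snd ≫ f) (by simp))
      (𝟙 _) (Iso.refl _) f (by simp) (by simp)).1 h0
  · exact (exact_iff_of_epi_iso_mono (S₁ := ShortComplex.mk (biprod.snd ≫ f) g (by simp [w]))
      (S₂ := ShortComplex.mk f g w) (biprod.snd : M ⊞ (N ⊞ V₀) ⟶ _) (Iso.refl _) (𝟙 _)
      (by simp) (by simp)).2 hS.exact

end HasFourTermExact

end FourTerm

/-- **Additivity of `K₀` over a four-term exact sequence of vector bundles**: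
`[M] + [V¹] = [V⁰] + [V²]` for `0 → M → V⁰ → V¹ → V² → 0` exact ("follows from additivity in `K₀`
applied to `E`"), splitting the sequence at `K = ker(V¹ → V²)`, a vector bundle (kernel of an
epimorphism of vector bundles, `Modules/KernelFiniteLocallyFree`, Stacks 05P2):
`[V¹] = [K] + [V²]` and `[V⁰] = [M] + [K]`. [cite: Grayson2013RelativeKTheory, Corollary 18 (proof)] -/
theorem HasFourTermExact.kZero_eq {M V₀ V₁ V₂ : X.Modules} (h : HasFourTermExact M V₀ V₁ V₂)
    (hM : IsFiniteLocallyFree M) (h₀ : IsFiniteLocallyFree V₀) (h₁ : IsFiniteLocallyFree V₁)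
    (h₂ : IsFiniteLocallyFree V₂) :
    KZero.of M hM + KZero.of V₁ h₁ = KZero.of V₀ h₀ + KZero.of V₂ h₂ := by
  obtain ⟨a, b, c, wab, wbc, ha, hc, hab, hbc⟩ := h
  have hK : IsFiniteLocallyFree (kernel c) := Modules.isFiniteLocallyFree_kernel c h₁ h₂
  -- `0 → K → V¹ → V² → 0`
  have hS₁ : (ShortComplex.kernelSequence c).ShortExact :=
    ShortComplex.ShortExact.mk' (ShortComplex.kernelSequence_exact c) inferInstance (by exact hc)
  have e₁ : KZero.of V₁ h₁ = KZero.of (kernel c) hK + KZero.of V₂ h₂ :=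
    KZero.of_shortExact hS₁ hK h₁ h₂
  -- `0 → M → V⁰ → K → 0`
  have hl : a ≫ kernel.lift c b wbc = 0 := by
    rw [← cancel_mono (kernel.ι c), Category.assoc, kernel.lift_ι, wab, zero_comp]
  have hepi : Epi (kernel.lift c b wbc) := hbc.epi_kernelLift
  have hS₂ : (ShortComplex.mk a (kernel.lift c b wbc) hl).ShortExact := by
    refine ShortComplex.ShortExact.mk' ?_ ha hepi
    exact (exact_iff_of_epi_iso_mono (S₁ := ShortComplex.mk a (kernel.lift c b wbc) hl)
      (S₂ := ShortComplex.mk a b wab) (𝟙 _) (Iso.refl _) (kernel.ι c) (by simp) (by simp)).2 hab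
  have e₂ : KZero.of V₀ h₀ = KZero.of M hM + KZero.of (kernel c) hK :=
    KZero.of_shortExact hS₂ hM h₀ hK
  rw [e₁, e₂]
  abel

/-- **Grayson's Corollary 18.** For vector bundles `M`, `M'` on a scheme `X`, `[M] = [M']` in `K₀(X)`
if and only if there exist vector bundles `V⁰, V¹, V²` and exact sequences
`0 → M → V⁰ → V¹ → V² → 0` and `0 → M' → V⁰ → V¹ → V² → 0` ("The classes `[M]` and `[M']` in `K₀𝒩`
are equal if and only if there exist three objects `V⁰, V¹, V²` of `𝒩` and two exact sequences of the
form `E : 0 → M → V⁰ → V¹ → V² → 0` and `E' : 0 → M' → V⁰ → V¹ → V² → 0`"). Proof as printed: `⟸` by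
additivity (`HasFourTermExact.kZero_eq`); `⟹` from Lemma 17 with the new `V⁰ := M ⊞ (M' ⊞ V⁰)`
(`≅ M' ⊞ (M ⊞ V⁰)`) and the sequences of `HasFourTermExact.of_hasSES`. This is the form in which the
criterion enters the exactness of `K₀Ω[F] → K₀𝓜 → K₀𝓝` (loc. cit., Lemma 19).
[cite: Grayson2013RelativeKTheory, Corollary 18] -/
theorem KZero.of_eq_of_iff_exists_fourTermExact {M M' : X.Modules} (hM : IsFiniteLocallyFree M)
    (hM' : IsFiniteLocallyFree M') :
    KZero.of M hM = KZero.of M' hM' ↔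
      ∃ (V₀ V₁ V₂ : X.Modules), IsFiniteLocallyFree V₀ ∧ IsFiniteLocallyFree V₁ ∧
        IsFiniteLocallyFree V₂ ∧ HasFourTermExact M V₀ V₁ V₂ ∧ HasFourTermExact M' V₀ V₁ V₂ := by
  constructor
  · intro h
    obtain ⟨V₀, V₁, V₂, h₀, h₁, h₂, hE, hE'⟩ := (KZero.of_eq_of_iff_hellerRel hM hM').1 h
    refine ⟨M ⊞ (M' ⊞ V₀), V₁, V₂,
      KZero.isFiniteLocallyFree_biprod hM (KZero.isFiniteLocallyFree_biprod hM' h₀), h₁, h₂,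
      HasFourTermExact.of_hasSES hE' M, (HasFourTermExact.of_hasSES hE M').of_iso₀ ?_⟩
    exact (biprod.associator M M' V₀).symm ≪≫ biprod.mapIso (biprod.braiding M M') (Iso.refl V₀) ≪≫
      biprod.associator M' M V₀
  · rintro ⟨V₀, V₁, V₂, h₀, h₁, h₂, hE, hE'⟩
    have e := hE.kZero_eq hM h₀ h₁ h₂
    rw [← hE'.kZero_eq hM' h₀ h₁ h₂] at e
    exact add_right_cancel e

/-! ## §6. Kernel classes of a pull-back, object-wise (towards Grayson's Lemma 19) -/

/-- Every class in `K₀(X)` is a difference `[M] − [M']` of classes of vector bundles (collect the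
positive and the negative generators into direct sums). [folklore] -/
theorem KZero.exists_eq_of_sub_of (x : KZero X) :
    ∃ (M M' : X.Modules) (hM : IsFiniteLocallyFree M) (hM' : IsFiniteLocallyFree M'),
      x = KZero.of M hM - KZero.of M' hM' := by
  have h0 : IsFiniteLocallyFree (0 : X.Modules) :=
    KZero.isFiniteLocallyFree_of_isZero (isZero_zero _)
  induction x using KZero.induction_on with
  | zero => exact ⟨0, 0, h0, h0, by rw [sub_self]⟩
  | of E hE => exact ⟨E, 0, hE, h0, by rw [KZero.of_isZero (isZero_zero _) h0, sub_zero]⟩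
  | neg x hx =>
    obtain ⟨M, M', hM, hM', rfl⟩ := hx
    exact ⟨M', M, hM', hM, by rw [neg_sub]⟩
  | add x y hx hy =>
    obtain ⟨M, M', hM, hM', rfl⟩ := hx
    obtain ⟨N, N', hN, hN', rfl⟩ := hy
    exact ⟨M ⊞ N, M' ⊞ N', KZero.isFiniteLocallyFree_biprod hM hN,
      KZero.isFiniteLocallyFree_biprod hM' hN', by
        rw [KZero.of_biprod hM hN, KZero.of_biprod hM' hN']; abel⟩

/-- **The kernel of `f^* : K₀(Z) → K₀(Y)`, object-wise.** A class `x ∈ K₀(Z)` dies in `K₀(Y)` iff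
`x = [M] − [M']` for vector bundles `M, M'` on `Z` whose pull-backs are Heller-related on `Y`, i.e.
admit vector bundles `V⁰, V¹, V²` on `Y` and short exact sequences `0 → f^*M ⊞ V⁰ → V¹ → V² → 0`,
`0 → f^*M' ⊞ V⁰ → V¹ → V² → 0` — the object-level content of the exactness of
`K₀Ω[F] → K₀𝓜 → K₀𝓝` at `K₀𝓜` for `F = f^*` (Grayson, Lemma 19: "we consider an arbitrary element
`[M] − [M']` of `K₀𝓜` killed by `F` … By (Corollary 18) applied to `FM` and `FM'` we find exact
sequences …"), prior to packaging the certificates into the presented group `K₀Ω[F]`.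
[cite: Grayson2013RelativeKTheory, Lemma 19 (proof), Lemma 17] -/
theorem KZero.map_eq_zero_iff_exists_hellerRel {Y Z : Scheme.{u}} (f : Y ⟶ Z) (x : KZero Z) :
    KZero.map f x = 0 ↔
      ∃ (M M' : Z.Modules) (hM : IsFiniteLocallyFree M) (hM' : IsFiniteLocallyFree M'),
        x = KZero.of M hM - KZero.of M' hM' ∧
          Heller.Rel ((Scheme.Modules.pullback f).obj M) ((Scheme.Modules.pullback f).obj M') := by
  constructor
  · intro hx
    obtain ⟨M, M', hM, hM', rfl⟩ := KZero.exists_eq_of_sub_of x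
    exact ⟨M, M', hM, hM', rfl, (KZero.map_of_sub_of_eq_zero_iff f hM hM').1 hx⟩
  · rintro ⟨M, M', hM, hM', rfl, h⟩
    exact (KZero.map_of_sub_of_eq_zero_iff f hM hM').2 h

end Literature.AlgebraicGeometry.KTheory

end
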